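import Summits.NavierStokesRegularity.NavierStokesRegularity.Theorems.TypeICertificateLadderTargetStretchingSlab
import Summits.NavierStokesRegularity.NavierStokesRegularity.Theorems.TypeICertificateLadderTargetStretchingDepletionOne
import Literature.Analysis.FluidPDE.NSVelocityUniqueness
import HarnessLib

/-!
# Crux `Target` = `TypeICertificateLadder.NoTypeIBlowup` (stmt-NavierStokesRegularity-1217), line
# `depletion-ladder`: the STRETCHING-NUMBER criterion (per-solution form of stub S2)

`--supports stmt-NavierStokesRegularity-1217` (line `depletion-ladder`; file 3/3 after
`…TargetStretchingSlice` and `…TargetStretchingSlab`).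

Define, along a classical solution on `[0,T)` with `ω = curl u`, the dimensionless STRETCHING NUMBER

  `S(t) := √((T−t)/ν) · ∫⟪ω, Du ω⟫(t) / (‖ω(t)‖₂ ‖∇ω(t)‖₂)`.

By Cauchy–Schwarz `S(t) ≤ √((T−t)/ν) ‖u(t)‖_∞ = Re(t)` (the collapse Reynolds number of the ladder),
and under the line's depletion hypothesis `S(t) ≤ κ̂ · Re(t)`. This file proves the per-solution
statement behind both rung one and stub S2:

* `hasSmoothExtensionPast_of_stretching_le` — if eventually `∫⟪ω, Du ω⟫ ≤ γ √(ν/(T−t)) ‖ω‖₂‖∇ω‖₂`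
  with `0 ≤ γ < 1` (i.e. `limsup S < 1`), the classical Leray–Hopf rapidly-decaying-datum solution
  extends past `T` (enstrophy `≲ (T−t)^{−γ²/2}` by the per-slice slab inequality, against the `H¹`
  blow-up rate, `hasSmoothExtensionPast_of_powerRate`);
* `frequently_stretching_gt_of_not_hasSmoothExtensionPast` — at a singular time, for every `γ < 1`
  the production exceeds `γ √(ν/(T−t)) ‖ω‖₂‖∇ω‖₂` at times accumulating at `T` (`limsup S ≥ 1`);
  in particular a Type-I(`C`) singularity has, frequently, depletion ratio `> κ` for every
  `κ < 1/C` — ONLY THE SOLUTION'S OWN near-blow-up slices need the depletion of stub S1, and at those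
  slices the companion constraints `R² + Q ≤ 1`, `R² + σ² ≤ 1` (p483448, `…DepletionSuperhelicity`)
  bite.

WHAT THIS IS NOT: no rung by itself (it is rung one's mechanism with the production in place of
the speed); the open content of the line is unchanged (S1). [folklore]

References: Lemarié-Rieusset 2016, Thm. 11.2; Leray 1934 §20 (the `H¹` rate).
-/

noncomputable section

open Set Filter Topology MeasureTheory
open scoped RealInnerProductSpace ENNReal NNReal Laplacian ContDiff
open Literature.Analysis.FluidPDE

namespace Summit.NavierStokesRegularity.NavierStokesRegularity.Theorems.DepletionLadder

-- the problem directory repeats the summit name (`NavierStokesRegularity/NavierStokesRegularity`)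
set_option linter.dupNamespace false

open Summit.NavierStokesRegularity.NavierStokesRegularity.Theorems.RungReynoldsOne
open Summit.NavierStokesRegularity.NavierStokesRegularity.Theorems.RungReynoldsOne.WeightedSlice

/-- **Cauchy–Schwarz production bound at a Tao-class slice** (`κ = 1` of the depletion family,
`stretchingDepletion_one`, with the integrability binders discharged from the Sobolev bounds):
`∫⟪ω, Du ω⟫ ≤ M √(∫‖ω‖²) √(∫|∇ω|²_F)` for `u ∈ C³` divergence free, `|u| ≤ M`, `‖Du‖ ≤ B`,
`Du, D²u ∈ L²`. [folklore] -/
theorem stretching_le_sup_mul {v : EuclideanSpace ℝ (Fin 3) → EuclideanSpace ℝ (Fin 3)}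
    (hv : ContDiff ℝ 3 v) (hdiv : VectorCalculus.IsDivFree v) {M B : ℝ} (hM : ∀ x, ‖v x‖ ≤ M)
    (hB : ∀ x, ‖fderiv ℝ v x‖ ≤ B)
    (h1 : ∫⁻ x, ‖iteratedFDeriv ℝ 1 v x‖ₑ ^ 2 < ⊤) (h2 : ∫⁻ x, ‖iteratedFDeriv ℝ 2 v x‖ₑ ^ 2 < ⊤) :
    ∫ x, ⟪curl v x, fderiv ℝ v x (curl v x)⟫ ≤
      M * Real.sqrt (∫ x, ‖curl v x‖ ^ 2) * Real.sqrt (∫ x, frobeniusNormSq (fderiv ℝ (curl v) x)) := by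
  have hv2 : ContDiff ℝ 2 v := hv.of_le (by norm_cast)
  have hv1 : ContDiff ℝ 1 v := hv.of_le (by norm_cast)
  have hω1 : ContDiff ℝ 1 (curl v) := by
    rw [curl_eq_curlCLM_comp]
    exact curlCLM.contDiff.comp (hv2.fderiv_right (m := 1) (by norm_cast))
  have cω : Continuous (curl v) := hω1.continuous
  have l2ω : ∫⁻ x, ‖curl v x‖ₑ ^ 2 < ⊤ := by
    refine lintegral_enorm_sq_lt_top_of_norm_le_const_mul ‖curlCLM‖ (fun x => ?_) h1
    rw [← norm_iteratedFDeriv_fderiv, norm_iteratedFDeriv_zero]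
    exact norm_curl_le v x
  have iZ : Integrable (fun x => ‖curl v x‖ ^ 2) volume := integrable_sq_norm_of_lintegral_lt_top cω l2ω
  have iA : Integrable (fun x => frobeniusNormSq (fderiv ℝ (curl v) x)) volume := by
    refine integrable_of_continuous_of_nonneg (continuous_frobeniusNormSq_fderiv hω1 one_ne_zero)
      (fun x => frobeniusNormSq_nonneg _) ?_
    exact (lintegral_ofReal_frobeniusNormSq_fderiv_curl_le hv2).trans_lt
      (ENNReal.mul_lt_top (ENNReal.mul_lt_top (by norm_num) ENNReal.ofReal_lt_top) h2)
  have iJ : Integrable (fun x => ⟪curl v x, fderiv ℝ v x (curl v x)⟫) volume := by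
    refine integrable_of_norm_le_const_mul_mul B
      (cω.inner ((hv1.continuous_fderiv one_ne_zero).clm_apply cω)) cω cω l2ω l2ω fun x => ?_
    calc ‖⟪curl v x, fderiv ℝ v x (curl v x)⟫‖ ≤ ‖curl v x‖ * ‖fderiv ℝ v x (curl v x)‖ :=
          norm_inner_le_norm _ _
      _ ≤ ‖curl v x‖ * (B * ‖curl v x‖) :=
          mul_le_mul_of_nonneg_left ((fderiv ℝ v x).le_of_opNorm_le (hB x) _) (norm_nonneg _)
      _ = B * ‖curl v x‖ * ‖curl v x‖ := by ring
  have h := stretchingDepletion_one v M hv2 hdiv hM iZ iA iJ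
  rw [one_mul] at h
  exact (le_abs_self _).trans h

/-- **A-priori power rate of the enstrophy under an eventual stretching-number bound.** Along a
classical solution on `ℝ³ × [0,T)`, Leray–Hopf from its rapidly decaying datum, with eventually
`∫⟪ω, Du ω⟫ ≤ γ √(ν/(T−t)) √(∫‖ω‖²) √(∫|∇ω|²_F)` (`γ ≥ 0`):
`∫ ‖curl u(t)‖² ≤ K (T−t)^{−γ²/2}` for some `K ≥ 0` and all `t ∈ (0,T)`. Proof: Cauchy–Schwarz
(`stretching_le_sup_mul`) before the onset, the hypothesis after, in
`lintegral_curl_sq_le_exp_stretching`; `∫₀ᵗ L² ≤ B₀²T + γ²ν log(T/(T−t))`. [folklore] -/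
theorem lintegral_curl_sq_le_rpow_of_stretching {ν T γ : ℝ} (hν : 0 < ν) (hT : 0 < T)
    {u : ℝ → EuclideanSpace ℝ (Fin 3) → EuclideanSpace ℝ (Fin 3)}
    {p : ℝ → EuclideanSpace ℝ (Fin 3) → ℝ}
    (hsol : IsClassicalNSSolutionOn (Ico 0 T) ν 0 u p) (hLH : IsLerayHopfOn T ν 0 (u 0) u)
    (hdec : HasRapidSpatialDecay (u 0))
    (hS : ∀ᶠ t in 𝓝[<] T, ∫ x, ⟪curl (u t) x, fderiv ℝ (u t) x (curl (u t) x)⟫ ≤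
      γ * Real.sqrt (ν / (T - t)) * Real.sqrt (∫ x, ‖curl (u t) x‖ ^ 2) *
        Real.sqrt (∫ x, frobeniusNormSq (fderiv ℝ (curl (u t)) x))) :
    ∃ K : ℝ, 0 ≤ K ∧ ∀ t ∈ Ioo 0 T,
      ∫⁻ x, ‖curl (u t) x‖ₑ ^ 2 ≤ ENNReal.ofReal (K * (T - t) ^ (-(γ ^ 2 / 2))) := by
  -- the onset `t₀ ∈ (0, T)` of the bound
  obtain ⟨a, haT, hsub⟩ := mem_nhdsLT_iff_exists_Ioo_subset.1 hS
  set t₀ : ℝ := (max a (T / 2) + T) / 2 with ht₀def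
  have hmax : max a (T / 2) < T := max_lt haT (by linarith)
  have hat₀ : a < t₀ := by
    have := le_max_left a (T / 2); rw [ht₀def]; linarith
  have ht₀ : t₀ ∈ Ioo 0 T := by
    have := le_max_right a (T / 2); rw [ht₀def]; constructor <;> linarith
  have hS' : ∀ s ∈ Ico t₀ T, ∫ x, ⟪curl (u s) x, fderiv ℝ (u s) x (curl (u s) x)⟫ ≤
      γ * Real.sqrt (ν / (T - s)) * Real.sqrt (∫ x, ‖curl (u s) x‖ ^ 2) *
        Real.sqrt (∫ x, frobeniusNormSq (fderiv ℝ (curl (u s)) x)) :=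
    fun s hs => hsub ⟨hat₀.trans_le hs.1, hs.2⟩
  -- a sup bound on `[0, t₀]` from the Tao cover at `T' = t₀`
  obtain ⟨q₀, hsol₀, hu₀, -, -⟩ := stub_taoCover hν hT hsol hLH hdec ht₀
  obtain ⟨B₀, hB₀0, hB₀⟩ := exists_forall_norm_le_of_hasBoundedSobolevNormsOn hsol₀ hu₀
  obtain ⟨C₁, hC₁⟩ := hu₀ 1
  -- the per-slice multiplier `L`
  set L : ℝ → ℝ := fun s => if s < t₀ then (eLpNorm (u s) ⊤ volume).toReal
    else γ * Real.sqrt (ν / (T - s)) with hL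
  have hLsq : ∀ s ∈ Ico 0 T, L s ^ 2 ≤ B₀ ^ 2 + γ ^ 2 * ν / (T - s) := by
    intro s hs
    have hTs : 0 < T - s := sub_pos.2 hs.2
    by_cases hst : s < t₀
    · have h1 : (eLpNorm (u s) ⊤ volume).toReal ≤ B₀ :=
        toReal_eLpNorm_top_le_of_bound hB₀0 (hB₀ s ⟨hs.1, hst.le⟩)
      have h2 : 0 ≤ γ ^ 2 * ν / (T - s) := by positivity
      have hL' : L s = (eLpNorm (u s) ⊤ volume).toReal := by simp [hL, hst]
      rw [hL']
      nlinarith [ENNReal.toReal_nonneg (a := eLpNorm (u s) ⊤ volume)]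
    · have hL' : L s = γ * Real.sqrt (ν / (T - s)) := by simp [hL, hst]
      rw [hL', mul_pow, Real.sq_sqrt (by positivity)]
      have : 0 ≤ B₀ ^ 2 := sq_nonneg _
      rw [mul_div_assoc]
      linarith
  -- the integrated bound `∫₀ᵗ L² ≤ B₀²T + γ²ν log(T/(T−t))`
  have hΛ : ∀ t ∈ Ioo 0 T,
      ∫⁻ s in Ioo 0 t, ENNReal.ofReal (L s ^ 2) ≤
        ENNReal.ofReal (B₀ ^ 2 * T + γ ^ 2 * ν * Real.log (T / (T - t))) := by
    intro t ht
    have hTt : 0 < T - t := sub_pos.2 ht.2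
    have hlog : 0 ≤ Real.log (T / (T - t)) :=
      Real.log_nonneg ((one_le_div hTt).2 (by linarith [ht.1]))
    have hC2 : 0 ≤ γ ^ 2 * ν := by positivity
    calc ∫⁻ s in Ioo 0 t, ENNReal.ofReal (L s ^ 2)
        ≤ ∫⁻ s in Ioo 0 t, (ENNReal.ofReal (B₀ ^ 2) + ENNReal.ofReal (γ ^ 2 * ν / (T - s))) := by
          refine setLIntegral_mono' measurableSet_Ioo fun s hs => ?_
          rw [← ENNReal.ofReal_add (sq_nonneg _) (div_nonneg hC2 (by linarith [hs.2, ht.2]))]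
          exact ENNReal.ofReal_le_ofReal (hLsq s ⟨hs.1.le, hs.2.trans ht.2⟩)
      _ = ENNReal.ofReal (B₀ ^ 2) * volume (Ioo 0 t) +
            ∫⁻ s in Ioo 0 t, ENNReal.ofReal (γ ^ 2 * ν / (T - s)) := by
          rw [lintegral_add_left measurable_const, setLIntegral_const]
      _ = ENNReal.ofReal (B₀ ^ 2 * t) + ENNReal.ofReal (γ ^ 2 * ν * Real.log (T / (T - t))) := by
          rw [lintegral_Ioo_div_sub_eq hC2 ht.1.le ht.2, Real.volume_Ioo, sub_zero,
            ← ENNReal.ofReal_mul (sq_nonneg _)]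
      _ = ENNReal.ofReal (B₀ ^ 2 * t + γ ^ 2 * ν * Real.log (T / (T - t))) :=
          (ENNReal.ofReal_add (mul_nonneg (sq_nonneg _) ht.1.le) (mul_nonneg hC2 hlog)).symm
      _ ≤ ENNReal.ofReal (B₀ ^ 2 * T + γ ^ 2 * ν * Real.log (T / (T - t))) := by
          refine ENNReal.ofReal_le_ofReal ?_
          nlinarith [sq_nonneg B₀, ht.2]
  -- finiteness of the enstrophy at time `0`
  have h00 : (0 : ℝ) ∈ Icc 0 t₀ := ⟨le_rfl, ht₀.1.le⟩
  have hZ0 : ∫⁻ x, ‖curl (u 0) x‖ₑ ^ 2 ≤ 6 * C₁ := by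
    calc ∫⁻ x, ‖curl (u 0) x‖ₑ ^ 2 ≤ ∫⁻ x, 6 * ‖iteratedFDeriv ℝ 1 (u 0) x‖ₑ ^ 2 :=
          lintegral_mono fun x => enorm_curl_sq_le_six_mul (u 0) x
      _ = 6 * ∫⁻ x, ‖iteratedFDeriv ℝ 1 (u 0) x‖ₑ ^ 2 := lintegral_const_mul' _ _ (by norm_num)
      _ ≤ 6 * C₁ := by gcongr; exact hC₁ 0 h00
  have hZ0top : ∫⁻ x, ‖curl (u 0) x‖ₑ ^ 2 ≠ ⊤ :=
    (hZ0.trans_lt (ENNReal.mul_lt_top (by norm_num) ENNReal.coe_lt_top)).ne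
  set Z0 : ℝ := (∫⁻ x, ‖curl (u 0) x‖ₑ ^ 2).toReal with hZ0def
  have hZ0nn : 0 ≤ Z0 := ENNReal.toReal_nonneg
  -- the constants
  set kν : ℝ := (2 * ν)⁻¹ with hkν
  have hk0 : 0 ≤ kν := by positivity
  set δ : ℝ := γ ^ 2 / 2 with hδ
  have hδk : kν * (γ ^ 2 * ν) = δ := by
    rw [hkν, hδ]
    field_simp
  set K : ℝ := Real.exp (kν * (B₀ ^ 2 * T)) * T ^ δ * Z0 with hK
  refine ⟨K, by positivity, fun t ht => ?_⟩
  obtain ⟨q, hsolt, hut, hutt, -⟩ := stub_taoCover hν hT hsol hLH hdec ht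
  have hTt : 0 < T - t := sub_pos.2 ht.2
  have hΛt := hΛ t ht
  have hΛtop : ∫⁻ s in Ioo 0 t, ENNReal.ofReal (L s ^ 2) ≠ ⊤ :=
    (hΛt.trans_lt ENNReal.ofReal_lt_top).ne
  -- the per-slice production bound on `(0, t)`
  obtain ⟨B₀', hB₀'0, hB₀'⟩ := exists_forall_norm_le_of_hasBoundedSobolevNormsOn hsolt hut
  obtain ⟨B₁, hB₁0, hB₁⟩ := exists_forall_norm_fderiv_le_of_hasBoundedSobolevNormsOn
    (fun s hs => (hsolt.contDiff_velocity hs).of_le (by norm_cast)) hut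
  obtain ⟨D₁, hD₁⟩ := hut 1
  obtain ⟨D₂, hD₂⟩ := hut 2
  have hJ : ∀ s ∈ Ioo 0 t, ∫ x, ⟪curl (u s) x, fderiv ℝ (u s) x (curl (u s) x)⟫ ≤
      L s * Real.sqrt (∫ x, ‖curl (u s) x‖ ^ 2) *
        Real.sqrt (∫ x, frobeniusNormSq (fderiv ℝ (curl (u s)) x)) := by
    intro s hs
    have hsI : s ∈ Icc 0 t := ⟨hs.1.le, hs.2.le⟩
    by_cases hst : s < t₀
    · have hL' : L s = (eLpNorm (u s) ⊤ volume).toReal := by simp [hL, hst]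
      rw [hL']
      have cu : Continuous (u s) := (hsolt.contDiff_velocity hsI).continuous
      have hLtop : eLpNorm (u s) ⊤ volume < ⊤ := by
        rw [eLpNorm_exponent_top]
        exact (eLpNormEssSup_le_of_ae_bound (Eventually.of_forall (hB₀' s hsI))).trans_lt
          ENNReal.ofReal_lt_top
      have hNpt : ∀ x, ‖u s x‖ ≤ (eLpNorm (u s) ⊤ volume).toReal := fun x =>
        norm_le_toReal_eLpNorm_top_of_continuous cu hLtop x
      exact stretching_le_sup_mul ((hsolt.contDiff_velocity hsI).of_le (by norm_cast))
        (hsolt.divFree s hsI) hNpt (hB₁ s hsI) ((hD₁ s hsI).trans_lt ENNReal.coe_lt_top)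
        ((hD₂ s hsI).trans_lt ENNReal.coe_lt_top)
    · have hL' : L s = γ * Real.sqrt (ν / (T - s)) := by simp [hL, hst]
      rw [hL']
      exact hS' s ⟨not_lt.1 hst, hs.2.trans ht.2⟩
  have hmain := lintegral_curl_sq_le_exp_stretching hν ht.1 hsolt hut hutt hJ ⟨ht.1, le_rfl⟩ hΛtop
  refine hmain.trans ?_
  have hlog : 0 ≤ Real.log (T / (T - t)) :=
    Real.log_nonneg ((one_le_div hTt).2 (by linarith [ht.1]))
  have hrhs0 : 0 ≤ B₀ ^ 2 * T + γ ^ 2 * ν * Real.log (T / (T - t)) := by positivity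
  have hexp : Real.exp ((2 * ν)⁻¹ *
      (∫⁻ s in Ioo 0 t, ENNReal.ofReal (L s ^ 2)).toReal) ≤
      Real.exp (kν * (B₀ ^ 2 * T)) * (T / (T - t)) ^ δ := by
    have h1 : (∫⁻ s in Ioo 0 t, ENNReal.ofReal (L s ^ 2)).toReal ≤
        B₀ ^ 2 * T + γ ^ 2 * ν * Real.log (T / (T - t)) := ENNReal.toReal_le_of_le_ofReal hrhs0 hΛt
    have h2 := Real.exp_le_exp.2 (mul_le_mul_of_nonneg_left h1 hk0)
    refine h2.trans_eq ?_
    rw [exp_mul_add_mul_log (div_pos hT hTt), hδk]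
  have hpow : (T / (T - t)) ^ δ = T ^ δ * (T - t) ^ (-δ) := by
    rw [Real.div_rpow hT.le hTt.le, Real.rpow_neg hTt.le, div_eq_mul_inv]
  calc ENNReal.ofReal (Real.exp ((2 * ν)⁻¹ *
        (∫⁻ s in Ioo 0 t, ENNReal.ofReal (L s ^ 2)).toReal)) * ∫⁻ x, ‖curl (u 0) x‖ₑ ^ 2
      ≤ ENNReal.ofReal (Real.exp (kν * (B₀ ^ 2 * T)) * (T / (T - t)) ^ δ) * ENNReal.ofReal Z0 := by
        rw [ENNReal.ofReal_toReal hZ0top]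
        gcongr
    _ = ENNReal.ofReal (K * (T - t) ^ (-δ)) := by
        rw [← ENNReal.ofReal_mul (by positivity), hpow, hK]
        ring_nf

/-- **The `H¹`-type power rate under an eventual stretching-number bound**:
`‖u(t)‖₂² + ‖∇u(t)‖₂² ≤ K′(T−t)^{−γ²/2}` on `[T/2, T)` (energy `≤ 2E(u₀)`, `∫|∇u|² ≤ ∫|curl u|²`,
`lintegral_curl_sq_le_rpow_of_stretching`). [folklore] -/
theorem energy_add_enstrophy_le_rpow_of_stretching {ν T γ : ℝ} (hν : 0 < ν) (hT : 0 < T)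
    {u : ℝ → EuclideanSpace ℝ (Fin 3) → EuclideanSpace ℝ (Fin 3)}
    {p : ℝ → EuclideanSpace ℝ (Fin 3) → ℝ}
    (hsol : IsClassicalNSSolutionOn (Ico 0 T) ν 0 u p) (hLH : IsLerayHopfOn T ν 0 (u 0) u)
    (hdec : HasRapidSpatialDecay (u 0))
    (hS : ∀ᶠ t in 𝓝[<] T, ∫ x, ⟪curl (u t) x, fderiv ℝ (u t) x (curl (u t) x)⟫ ≤
      γ * Real.sqrt (ν / (T - t)) * Real.sqrt (∫ x, ‖curl (u t) x‖ ^ 2) *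
        Real.sqrt (∫ x, frobeniusNormSq (fderiv ℝ (curl (u t)) x))) :
    ∃ K : ℝ, ∃ t₀ ∈ Ico 0 T, ∀ t ∈ Ico t₀ T,
      (∫⁻ x, ‖u t x‖ₑ ^ 2) + ∫⁻ x, ENNReal.ofReal (frobeniusNormSq (fderiv ℝ (u t) x)) ≤
        ENNReal.ofReal (K * (T - t) ^ (-(γ ^ 2 / 2))) := by
  obtain ⟨K, hK0, hK⟩ := lintegral_curl_sq_le_rpow_of_stretching hν hT hsol hLH hdec hS
  set δ : ℝ := γ ^ 2 / 2 with hδ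
  have hδ0 : 0 ≤ δ := by positivity
  set E₀ : ℝ := 2 * VectorCalculus.kineticEnergy (u 0) with hE₀
  have hE : ∀ t ∈ Icc 0 T, ∫⁻ x, ‖u t x‖ₑ ^ 2 ≤ ENNReal.ofReal (max E₀ 0) := fun t ht =>
    (hLH.lintegral_enorm_sq_le hν.le ht).trans (ENNReal.ofReal_le_ofReal (le_max_left _ _))
  refine ⟨max E₀ 0 * T ^ δ + K, T / 2, ⟨by positivity, by linarith⟩, fun t ht => ?_⟩
  have ht' : t ∈ Ioo 0 T := ⟨lt_of_lt_of_le (by positivity) ht.1, ht.2⟩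
  have htc : t ∈ Icc 0 T := ⟨ht'.1.le, ht'.2.le⟩
  have htI : t ∈ Ico 0 T := ⟨ht'.1.le, ht'.2⟩
  have hTt : 0 < T - t := sub_pos.2 ht.2
  have hL2 : ∫⁻ x, ‖u t x‖ₑ ^ 2 < ⊤ := (hE t htc).trans_lt ENNReal.ofReal_lt_top
  have hG : ∫⁻ x, ENNReal.ofReal (frobeniusNormSq (fderiv ℝ (u t) x)) ≤ ∫⁻ x, ‖curl (u t) x‖ₑ ^ 2 :=
    lintegral_frobeniusNormSq_fderiv_le_lintegral_sq_norm_curl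
      ((hsol.contDiff_velocity htI).of_le (by norm_cast)) (hsol.divFree t htI) hL2
  have hone : 1 ≤ T ^ δ * (T - t) ^ (-δ) := by
    rw [Real.rpow_neg hTt.le, ← div_eq_mul_inv, ← Real.div_rpow hT.le hTt.le]
    exact Real.one_le_rpow ((one_le_div hTt).2 (by linarith [ht'.1])) hδ0
  have hE' : max E₀ 0 ≤ max E₀ 0 * T ^ δ * (T - t) ^ (-δ) := by
    have := mul_le_mul_of_nonneg_left hone (le_max_right E₀ 0)
    rw [mul_one] at this
    simpa [mul_assoc] using this
  calc (∫⁻ x, ‖u t x‖ₑ ^ 2) + ∫⁻ x, ENNReal.ofReal (frobeniusNormSq (fderiv ℝ (u t) x))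
      ≤ ENNReal.ofReal (max E₀ 0) + ENNReal.ofReal (K * (T - t) ^ (-δ)) :=
        add_le_add (hE t htc) (hG.trans (hK t ht'))
    _ = ENNReal.ofReal (max E₀ 0 + K * (T - t) ^ (-δ)) :=
        (ENNReal.ofReal_add (le_max_right _ _) (by positivity)).symm
    _ ≤ ENNReal.ofReal ((max E₀ 0 * T ^ δ + K) * (T - t) ^ (-δ)) := by
        refine ENNReal.ofReal_le_ofReal ?_
        rw [add_mul]
        exact add_le_add hE' le_rfl

/-- **The stretching-number criterion.** A classical solution of the unforced Navier–Stokes system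
on `ℝ³ × [0,T)`, Leray–Hopf from its rapidly decaying datum, whose enstrophy production eventually
satisfies `∫⟪ω, Du ω⟫(t) ≤ γ · √(ν/(T−t)) · ‖ω(t)‖₂ · ‖∇ω(t)‖₂` with `0 ≤ γ < 1`, extends smoothly
past `T`. (Rung one `C ≤ 1` and stub S2 `κC < 1` are the instances `γ = C` by Cauchy–Schwarz and
`γ = κC` under depletion.) [folklore] -/
theorem hasSmoothExtensionPast_of_stretching_le {ν T γ : ℝ} (hν : 0 < ν) (hT : 0 < T)
    (hγ : 0 ≤ γ) (hγ1 : γ < 1)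
    {u : ℝ → EuclideanSpace ℝ (Fin 3) → EuclideanSpace ℝ (Fin 3)}
    {p : ℝ → EuclideanSpace ℝ (Fin 3) → ℝ}
    (hsol : IsClassicalNSSolutionOn (Ico 0 T) ν 0 u p) (hLH : IsLerayHopfOn T ν 0 (u 0) u)
    (hdec : HasRapidSpatialDecay (u 0))
    (hS : ∀ᶠ t in 𝓝[<] T, ∫ x, ⟪curl (u t) x, fderiv ℝ (u t) x (curl (u t) x)⟫ ≤
      γ * Real.sqrt (ν / (T - t)) * Real.sqrt (∫ x, ‖curl (u t) x‖ ^ 2) *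
        Real.sqrt (∫ x, frobeniusNormSq (fderiv ℝ (curl (u t)) x))) :
    HasSmoothExtensionPast ν 0 u T := by
  have hδ : γ ^ 2 / 2 < 1 / 2 := by nlinarith
  obtain ⟨K, t₀, ht₀, hK⟩ := energy_add_enstrophy_le_rpow_of_stretching hν hT hsol hLH hdec hS
  exact hasSmoothExtensionPast_of_powerRate hν hT hδ hsol hLH hdec ⟨t₀, ht₀, hK⟩

/-- **Portrait of a singular time: the stretching number reaches `1`.** If the classical
Leray–Hopf rapidly-decaying-datum solution does NOT extend past `T`, then for every `γ ∈ [0,1)` the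
enstrophy production exceeds `γ √(ν/(T−t)) ‖ω‖₂‖∇ω‖₂` at times accumulating at `T`
(`limsup_{t↑T} S(t) ≥ 1`). With a Type-I rate `√(T−t)‖u(t)‖_∞ ≤ C√ν` and `γ = κC` this says: the
solution's own depletion ratio exceeds `κ` frequently, for every `κ < 1/C`. [folklore] -/
theorem frequently_stretching_gt_of_not_hasSmoothExtensionPast {ν T γ : ℝ} (hν : 0 < ν) (hT : 0 < T)
    (hγ : 0 ≤ γ) (hγ1 : γ < 1)
    {u : ℝ → EuclideanSpace ℝ (Fin 3) → EuclideanSpace ℝ (Fin 3)}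
    {p : ℝ → EuclideanSpace ℝ (Fin 3) → ℝ}
    (hsol : IsClassicalNSSolutionOn (Ico 0 T) ν 0 u p) (hLH : IsLerayHopfOn T ν 0 (u 0) u)
    (hdec : HasRapidSpatialDecay (u 0)) (hsing : ¬ HasSmoothExtensionPast ν 0 u T) :
    ∃ᶠ t in 𝓝[<] T, γ * Real.sqrt (ν / (T - t)) * Real.sqrt (∫ x, ‖curl (u t) x‖ ^ 2) *
        Real.sqrt (∫ x, frobeniusNormSq (fderiv ℝ (curl (u t)) x)) <
      ∫ x, ⟪curl (u t) x, fderiv ℝ (u t) x (curl (u t) x)⟫ := by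
  by_contra h
  have h' : ∀ᶠ t in 𝓝[<] T, ∫ x, ⟪curl (u t) x, fderiv ℝ (u t) x (curl (u t) x)⟫ ≤
      γ * Real.sqrt (ν / (T - t)) * Real.sqrt (∫ x, ‖curl (u t) x‖ ^ 2) *
        Real.sqrt (∫ x, frobeniusNormSq (fderiv ℝ (curl (u t)) x)) := by
    simpa [Filter.not_frequently, not_lt] using h
  exact hsing (hasSmoothExtensionPast_of_stretching_le hν hT hγ hγ1 hsol hLH hdec h')

end Summit.NavierStokesRegularity.NavierStokesRegularity.Theorems.DepletionLadder

end
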